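import Summits.AtomisticToContinuum.HydrodynamicLimit.Theorems.OneFlightGossipEngineEnergyCurrentTailsLevelCensusClosureBarrier
import Mathlib.Analysis.PSeries
import HarnessLib

/-!
# Census closure, arithmetic core II: the merge classes of the pair majorant
# (stub C of the line `level-census-comparison`, crux `EnergyCurrentTails`, stmt-AtomisticToContinuum-9235)

Second measure-free file behind the registered stub `stub_censusClosure` (helper file of the line
lead's seat c2; registered main theorem `census_mergeSum_le`).  With the barrier
`b(E) = βM e^{−αE}/E²` (`E₀ = RΔ`, `α = L/E₀`, `β = m₂e^{L}E₀`) of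
`…LevelCensusClosureBarrier` and an abstract census majorant `nhi` (`0 ≤ nhi`, Chebyshev
`nhi E' ≤ M m₂/E'`, `nhi ≤ b + δ₀` above `E₀`), the MERGE part of the pair majorant of stub F2,
`∑_{k=1}^{⌈E/2Δ⌉} nhi(E−(k+1)Δ) · nhi(kΔ)`, is at most `96 e^{L} R M b(E) m₂/Δ + 3Mδ₀⌈E/2Δ⌉` for
every `E ≥ E₀` (`R ≥ 8`, `8L ≤ R`, `m₂ ≤ Δ`).  Case by case (`merge_term_le`): the slow partner
`kΔ` is Chebyshev below `E₀` (`k < R`, then the fast factor is `≤ 16e^{L} b(E)`) or a barrier value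
(`k ≥ R`, then the two exponentials multiply to `e^{−α(E−Δ)}` and the power laws sum by
`∑ 1/k² ≤ 2`).-/

noncomputable section

open Real Finset

namespace Summit.AtomisticToContinuum.HydrodynamicLimit.Theorems.EnergyCurrentTailsLevelCensus

/-! ## The merge classes `(E−(k+1)Δ, E−kΔ] × (kΔ, ∞)`, `1 ≤ k ≤ ⌈E/(2Δ)⌉` -/

section Merge

variable {M m₂ L Δ E₀ α β δ₀ : ℝ} {R : ℕ} {b nhi : ℝ → ℝ}

/-- Merge class, both factors barrier values (`y, kΔ ≥ E₀`): the exponentials multiply to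
`e^{αΔ} ≤ e^{1/8}`, the power laws give `16 βM/(kΔ)²`. -/
theorem merge_prod_bb_le (hb : ∀ E, b E = β * M * Real.exp (-(α * E)) / E ^ 2) (hβ : 0 < β)
    (hM : 0 < M) (hΔ : 0 < Δ) (hβMΔ : β * M / Δ ^ 2 = Real.exp L * M * (m₂ / Δ) * R)
    (hαΔ : α * Δ ≤ 1 / 8) {E y k : ℝ} (hE : 0 < E) (hy : 0 < y) (hk : 0 < k)
    (hsum : E - y - k * Δ = Δ) (hEy : (E / y) ^ 2 ≤ 16) :
    b y * b (k * Δ) ≤ 32 * Real.exp L * M * b E * (m₂ / Δ) * (R / k ^ 2) := by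
  have hbE : 0 < b E := barrier_pos hb hβ hM hE.ne'
  have hkΔ : 0 < k * Δ := by positivity
  rw [barrier_mul_barrier hb hE.ne' hy.ne' hkΔ.ne', hsum]
  have h2 : Real.exp (α * Δ) ≤ 2 := by
    have h' := Real.exp_le_exp.2 hαΔ
    have exp_one_eighth_le : Real.exp (1 / 8) ≤ 5 / 4 := by
      have h := Real.abs_exp_sub_one_le (x := 1 / 8) (by rw [abs_le]; constructor <;> norm_num)
      rw [abs_le] at h; norm_num at h; linarith [h.2]
    linarith
  have h3 : (E / (y * (k * Δ))) ^ 2 ≤ 16 / (k * Δ) ^ 2 := by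
    rw [← div_div, div_pow]
    exact div_le_div_of_nonneg_right hEy (by positivity)
  calc b E * (β * M * Real.exp (α * Δ) * (E / (y * (k * Δ))) ^ 2)
      ≤ b E * (β * M * 2 * (16 / (k * Δ) ^ 2)) := by
        apply mul_le_mul_of_nonneg_left _ hbE.le
        apply mul_le_mul _ h3 (by positivity) (by positivity)
        exact mul_le_mul_of_nonneg_left h2 (by positivity)
    _ = 32 * (β * M / Δ ^ 2) * b E * (1 / k ^ 2) := by
        field_simp; norm_num
    _ = 32 * Real.exp L * M * b E * (m₂ / Δ) * (R / k ^ 2) := by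
        rw [hβMΔ]; field_simp

/-- Merge class, first factor Chebyshev (`y < E₀ ≤ kΔ`): `b(kΔ)` carries `e^{−α(E−Δ−y)} ≤
e^{L + 1/8} e^{−αE}`, and `E < 4E₀ = 4RΔ`. -/
theorem merge_prod_cb_le (hb : ∀ E, b E = β * M * Real.exp (-(α * E)) / E ^ 2) (hβ : 0 < β)
    (hM : 0 < M) (hm₂ : 0 < m₂) (hΔ : 0 < Δ) {E y k : ℝ} (hE : 0 < E)
    (hy : 0 < y) (hk : 0 < k) (hy4 : E ≤ 4 * y) (hℓ : α * (E - k * Δ) ≤ L + 1 / 8)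
    (hE4 : E / Δ ≤ 4 * R) :
    M * m₂ / y * b (k * Δ) ≤ 32 * Real.exp L * M * b E * (m₂ / Δ) * (R / k ^ 2) := by
  have hbE : 0 < b E := barrier_pos hb hβ hM hE.ne'
  have hkΔ : 0 < k * Δ := by positivity
  have hbk : b (k * Δ) ≤ Real.exp (L + 1 / 8) * (E / (k * Δ)) ^ 2 * b E := by
    refine barrier_le_of_ratio hb hβ hM hE hkΔ (le_of_eq ?_) hℓ
    field_simp
  have hX4 : M * m₂ / y ≤ 4 * M * m₂ / E := by
    rw [div_le_div_iff₀ hy hE]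
    have := mul_le_mul_of_nonneg_left hy4 (show 0 ≤ M * m₂ by positivity)
    linarith
  have hexp : Real.exp (L + 1 / 8) ≤ 2 * Real.exp L := by
    rw [Real.exp_add]
    have exp_one_eighth_le : Real.exp (1 / 8) ≤ 5 / 4 := by
      have h := Real.abs_exp_sub_one_le (x := 1 / 8) (by rw [abs_le]; constructor <;> norm_num)
      rw [abs_le] at h; norm_num at h; linarith [h.2]
    nlinarith [Real.exp_pos L, exp_one_eighth_le]
  have hbk0 : 0 ≤ b (k * Δ) := (barrier_pos hb hβ hM hkΔ.ne').le
  calc M * m₂ / y * b (k * Δ)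
      ≤ (4 * M * m₂ / E) * (Real.exp (L + 1 / 8) * (E / (k * Δ)) ^ 2 * b E) :=
        mul_le_mul hX4 hbk hbk0 (by positivity)
    _ ≤ (4 * M * m₂ / E) * (2 * Real.exp L * (E / (k * Δ)) ^ 2 * b E) := by
        apply mul_le_mul_of_nonneg_left _ (by positivity)
        apply mul_le_mul_of_nonneg_right _ hbE.le
        exact mul_le_mul_of_nonneg_right hexp (by positivity)
    _ = 8 * Real.exp L * M * b E * (m₂ / Δ) * (E / Δ) * (1 / k ^ 2) := by
        field_simp; norm_num
    _ ≤ 8 * Real.exp L * M * b E * (m₂ / Δ) * (4 * R) * (1 / k ^ 2) := by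
        have h0 : 0 ≤ 8 * Real.exp L * M * b E * (m₂ / Δ) := by positivity
        apply mul_le_mul_of_nonneg_right _ (by positivity)
        exact mul_le_mul_of_nonneg_left hE4 h0
    _ = 32 * Real.exp L * M * b E * (m₂ / Δ) * (R / k ^ 2) := by ring

/-- Merge class with `(k+1)Δ ≤ E₀`: the first factor is `≤ 16 e^{L} b(E)` up to `δ₀`, in both
regimes of `y = E − (k+1)Δ` (barrier: `e^{α(k+1)Δ} ≤ e^{L}`; Chebyshev: `E < 2E₀`). -/
theorem merge_first_le (hb : ∀ E, b E = β * M * Real.exp (-(α * E)) / E ^ 2) (hM : 0 < M)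
    (hm₂ : 0 < m₂) (hL : 0 ≤ L) (hm₂E₀ : m₂ ≤ E₀) (hα : α = L / E₀)
    (hβ : β = m₂ * Real.exp L * E₀) (h2 : ∀ E', 0 < E' → nhi E' ≤ M * m₂ / E')
    (h4 : ∀ E', E₀ ≤ E' → nhi E' ≤ b E' + δ₀) (hδ₀ : 0 ≤ δ₀) {E y : ℝ} (hE : E₀ ≤ E)
    (hy : 0 < y) (hy4 : E ≤ 4 * y) (hyE₀ : E - y ≤ E₀) (hmy : m₂ ≤ y) :
    ∃ X : ℝ, nhi y ≤ X + δ₀ ∧ X ≤ M ∧ X ≤ 16 * Real.exp L * b E := by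
  have hE₀ : 0 < E₀ := lt_of_lt_of_le hm₂ hm₂E₀
  have hEpos : 0 < E := lt_of_lt_of_le hE₀ hE
  have hβpos : 0 < β := by rw [hβ]; positivity
  have hαnn : 0 ≤ α := by rw [hα]; positivity
  have hαE₀ : α * E₀ = L := by rw [hα]; field_simp
  by_cases hyE₀' : E₀ ≤ y
  · refine ⟨b y, h4 _ hyE₀', barrier_le_M hb hM hm₂ hm₂E₀ hα hβ hL hyE₀', ?_⟩
    have h := barrier_le_of_ratio hb hβpos hM hEpos hy (κ := 4) (ℓ := L) hy4 ?_
    · linarith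
    · calc α * (E - y) ≤ α * E₀ := mul_le_mul_of_nonneg_left hyE₀ hαnn
        _ = L := hαE₀
  · push Not at hyE₀'
    refine ⟨M * m₂ / y, by linarith [h2 y hy], ?_, ?_⟩
    · rw [div_le_iff₀ hy]; exact mul_le_mul_of_nonneg_left hmy hM.le
    · have hE2 : E ≤ 2 * E₀ := by linarith
      have h := chebyshev_le_of_ratio hb hM hm₂ hE₀ hα hβ hEpos hy (κ₁ := 2) (κ₂ := 4)
        (ℓ := L) ?_ hE2 (by linarith)
      · linarith
      · calc α * (E - E₀) ≤ α * E₀ := mul_le_mul_of_nonneg_left (by linarith) hαnn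
          _ = L := hαE₀

/-- **One merge class.**  For `E ≥ E₀ = RΔ` (`R ≥ 8`, `8L ≤ R`, `m₂ ≤ Δ`) and
`1 ≤ k ≤ ⌈E/(2Δ)⌉`: `nhi(E−(k+1)Δ) · nhi(kΔ) ≤ 32 e^{L} M b(E) (m₂/Δ) (𝟙{k ≤ R} + R/k²) + 3Mδ₀`. -/
theorem merge_term_le (hb : ∀ E, b E = β * M * Real.exp (-(α * E)) / E ^ 2) (hM : 1 ≤ M)
    (hm₂ : 0 < m₂) (hL : 0 ≤ L) (hR8 : 8 ≤ (R : ℝ)) (hRL : 8 * L ≤ R) (hΔ : m₂ ≤ Δ)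
    (hE₀ : E₀ = R * Δ) (hα : α = L / E₀) (hβ : β = m₂ * Real.exp L * E₀)
    (h0 : ∀ E', 0 ≤ nhi E') (h2 : ∀ E', 0 < E' → nhi E' ≤ M * m₂ / E')
    (h4 : ∀ E', E₀ ≤ E' → nhi E' ≤ b E' + δ₀) (hδ₀ : 0 ≤ δ₀) (hδM : δ₀ ≤ M)
    {E : ℝ} (hE : E₀ ≤ E) {k : ℕ} (hk1 : 1 ≤ k) (hkK : k ≤ ⌈E / (2 * Δ)⌉₊) :
    nhi (E - ((k : ℝ) + 1) * Δ) * nhi ((k : ℝ) * Δ)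
      ≤ 32 * Real.exp L * M * b E * (m₂ / Δ) * ((if k ≤ R then (1 : ℝ) else 0) + R / (k : ℝ) ^ 2)
        + 3 * M * δ₀ := by
  -- common facts
  have hM0 : 0 < M := lt_of_lt_of_le one_pos hM
  have hΔ0 : 0 < Δ := lt_of_lt_of_le hm₂ hΔ
  have hE₀8 : 8 * Δ ≤ E₀ := by
    rw [hE₀]; exact mul_le_mul_of_nonneg_right hR8 hΔ0.le
  have hE₀pos : 0 < E₀ := by linarith
  have hm₂E₀ : m₂ ≤ E₀ := by linarith
  have hEpos : 0 < E := by linarith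
  have hβpos : 0 < β := by rw [hβ]; positivity
  have hαnn : 0 ≤ α := by rw [hα]; positivity
  have hαE₀ : α * E₀ = L := by rw [hα]; field_simp
  have hαΔ : α * Δ ≤ 1 / 8 := by
    rw [hα, hE₀, div_mul_eq_mul_div, div_le_iff₀ (by positivity)]
    have := mul_le_mul_of_nonneg_right hRL hΔ0.le
    linarith
  have hk1' : (1 : ℝ) ≤ k := by exact_mod_cast hk1
  have hk0 : (0 : ℝ) < k := by linarith
  have hK : ((⌈E / (2 * Δ)⌉₊ : ℕ) : ℝ) < E / (2 * Δ) + 1 := Nat.ceil_lt_add_one (by positivity)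
  have hkK' : (k : ℝ) ≤ ⌈E / (2 * Δ)⌉₊ := by exact_mod_cast hkK
  have hk34 : ((k : ℝ) + 1) * Δ < 3 * E / 4 := by
    have h1 : ((k : ℝ) + 1) * Δ < (E / (2 * Δ) + 2) * Δ := by
      apply mul_lt_mul_of_pos_right _ hΔ0; linarith
    have h2 : (E / (2 * Δ) + 2) * Δ = E / 2 + 2 * Δ := by field_simp
    rw [h2] at h1
    linarith
  set y : ℝ := E - ((k : ℝ) + 1) * Δ with hydef
  have hy4 : E ≤ 4 * y := by rw [hydef]; linarith
  have hypos : 0 < y := by linarith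
  have hmy : m₂ ≤ y := by linarith
  have hkΔpos : 0 < (k : ℝ) * Δ := by positivity
  have hbE : 0 < b E := barrier_pos hb hβpos hM0 hEpos.ne'
  have hβMΔ : β * M / Δ ^ 2 = Real.exp L * M * (m₂ / Δ) * R := by
    rw [hβ, hE₀]; field_simp
  have hEy : (E / y) ^ 2 ≤ 16 := by
    have h0 : 0 ≤ E / y := by positivity
    have h1 : E / y ≤ 4 := by rw [div_le_iff₀ hypos]; linarith
    nlinarith
  have hC0 : 0 ≤ 32 * Real.exp L * M * b E * (m₂ / Δ) := by positivity
  by_cases hkR : R ≤ k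
  · -- `kΔ ≥ E₀`: the second factor is a barrier value
    have hkR' : (R : ℝ) ≤ k := by exact_mod_cast hkR
    have hkΔ : E₀ ≤ (k : ℝ) * Δ := by rw [hE₀]; exact mul_le_mul_of_nonneg_right hkR' hΔ0.le
    have hind : (R : ℝ) / (k : ℝ) ^ 2 ≤ (if k ≤ R then (1 : ℝ) else 0) + R / (k : ℝ) ^ 2 := by
      split_ifs <;> [linarith; linarith]
    have hY : nhi ((k : ℝ) * Δ) ≤ b ((k : ℝ) * Δ) + δ₀ := h4 _ hkΔ
    have hYM : b ((k : ℝ) * Δ) ≤ M := barrier_le_M hb hM0 hm₂ hm₂E₀ hα hβ hL hkΔ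
    have hstep : ∀ X : ℝ, nhi y ≤ X + δ₀ → X ≤ M →
        X * b ((k : ℝ) * Δ) ≤ 32 * Real.exp L * M * b E * (m₂ / Δ) * (R / (k : ℝ) ^ 2) →
        nhi y * nhi ((k : ℝ) * Δ) ≤ 32 * Real.exp L * M * b E * (m₂ / Δ) *
          ((if k ≤ R then (1 : ℝ) else 0) + R / (k : ℝ) ^ 2) + 3 * M * δ₀ := by
      intro X hX hXM hprod
      have h1 := mul_le_mul_add_three (h0 y) (h0 _) hX hY hXM hYM hδ₀ hδM
      have h2 := mul_le_mul_of_nonneg_left hind hC0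
      linarith
    by_cases hyE₀ : E₀ ≤ y
    · -- (ii-a)
      refine hstep (b y) (h4 _ hyE₀) (barrier_le_M hb hM0 hm₂ hm₂E₀ hα hβ hL hyE₀) ?_
      exact merge_prod_bb_le hb hβpos hM0 hΔ0 hβMΔ hαΔ hEpos hypos hk0 (by rw [hydef]; ring) hEy
    · -- (ii-b)
      push Not at hyE₀
      refine hstep (M * m₂ / y) (by linarith [h2 y hypos]) ?_ ?_
      · rw [div_le_iff₀ hypos]; exact mul_le_mul_of_nonneg_left hmy hM0.le
      · refine merge_prod_cb_le hb hβpos hM0 hm₂ hΔ0 hEpos hypos hk0 hy4 ?_ ?_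
        · have h1 : E - (k : ℝ) * Δ = y + Δ := by rw [hydef]; ring
          rw [h1, mul_add]
          have : α * y ≤ L := by
            calc α * y ≤ α * E₀ := mul_le_mul_of_nonneg_left hyE₀.le hαnn
              _ = L := hαE₀
          linarith
        · rw [div_le_iff₀ hΔ0]
          have : E < 4 * E₀ := by linarith
          rw [hE₀] at this
          linarith
  · -- `kΔ < E₀` (`k + 1 ≤ R`): the second factor is Chebyshev `≤ M m₂/Δ`, the first `≤ 16 e^{L} b E`
    push Not at hkR
    have hkR' : (k : ℝ) + 1 ≤ R := by exact_mod_cast hkR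
    have hkΔE₀ : ((k : ℝ) + 1) * Δ ≤ E₀ := by
      rw [hE₀]; exact mul_le_mul_of_nonneg_right hkR' hΔ0.le
    have hind : (1 : ℝ) ≤ (if k ≤ R then (1 : ℝ) else 0) + R / (k : ℝ) ^ 2 := by
      rw [if_pos hkR.le]
      have : 0 ≤ (R : ℝ) / (k : ℝ) ^ 2 := by positivity
      linarith
    have hY : nhi ((k : ℝ) * Δ) ≤ M * m₂ / ((k : ℝ) * Δ) + δ₀ := by linarith [h2 _ hkΔpos]
    have hmk : m₂ ≤ (k : ℝ) * Δ := hΔ.trans (le_mul_of_one_le_left hΔ0.le hk1')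
    have hYM : M * m₂ / ((k : ℝ) * Δ) ≤ M := by
      rw [div_le_iff₀ hkΔpos]; exact mul_le_mul_of_nonneg_left hmk hM0.le
    have hY0 : 0 ≤ M * m₂ / ((k : ℝ) * Δ) := by positivity
    have hYΔ : M * m₂ / ((k : ℝ) * Δ) ≤ M * (m₂ / Δ) := by
      rw [mul_div_assoc]
      apply mul_le_mul_of_nonneg_left _ hM0.le
      apply div_le_div_of_nonneg_left hm₂.le hΔ0
      exact le_mul_of_one_le_left hΔ0.le hk1'
    obtain ⟨X, hX, hXM, hX16⟩ := merge_first_le hb hM0 hm₂ hL hm₂E₀ hα hβ h2 h4 hδ₀ hE hypos hy4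
      (by rw [hydef]; linarith) hmy
    have h1 := mul_le_mul_add_three (h0 y) (h0 _) hX hY hXM hYM hδ₀ hδM
    have h3 : X * (M * m₂ / ((k : ℝ) * Δ)) ≤ (16 * Real.exp L * b E) * (M * (m₂ / Δ)) :=
      mul_le_mul hX16 hYΔ hY0 (by positivity)
    have h5 : (16 * Real.exp L * b E) * (M * (m₂ / Δ))
        ≤ 32 * Real.exp L * M * b E * (m₂ / Δ) * ((if k ≤ R then (1 : ℝ) else 0) + R / (k : ℝ) ^ 2) := by
      have := mul_le_mul_of_nonneg_left hind hC0
      nlinarith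
    linarith

/-- `∑_{k=1}^{K} 1/k² ≤ 2`. -/
theorem sum_Icc_inv_sq_le_two (K : ℕ) : ∑ k ∈ Finset.Icc 1 K, ((k : ℝ) ^ 2)⁻¹ ≤ 2 := by
  have h : Finset.Icc 1 K = Finset.Ioo 0 (K + 1) := by
    ext x; simp only [Finset.mem_Icc, Finset.mem_Ioo]; omega
  rw [h]
  have := sum_Ioo_inv_sq_le (α := ℝ) 0 (K + 1)
  norm_num at this
  exact this

/-- `#{k ∈ [1, K] : k ≤ R} ≤ R`, as a real sum of indicators. -/
theorem sum_Icc_indicator_le (K R : ℕ) :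
    ∑ k ∈ Finset.Icc 1 K, (if k ≤ R then (1 : ℝ) else 0) ≤ R := by
  rw [Finset.sum_boole]
  have h : ((Finset.Icc 1 K).filter (fun k => k ≤ R)).card ≤ (Finset.Icc 1 R).card := by
    apply Finset.card_le_card
    intro x hx
    simp only [Finset.mem_filter, Finset.mem_Icc] at hx ⊢
    omega
  rw [Nat.card_Icc] at h
  have h' : ((Finset.Icc 1 K).filter (fun k => k ≤ R)).card ≤ R := by omega
  exact_mod_cast h'

/-- **The merge sum** (registered main theorem of this file): for `E ≥ E₀ = RΔ`,
`∑_{k=1}^{⌈E/2Δ⌉} nhi(E−(k+1)Δ) nhi(kΔ) ≤ 96 e^{L} R M b(E) m₂/Δ + 3Mδ₀ ⌈E/2Δ⌉`. -/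
theorem census_mergeSum_le :
    ∀ (M m₂ L Δ E₀ α β δ₀ : ℝ) (R : ℕ) (b nhi : ℝ → ℝ),
      (∀ E, b E = β * M * Real.exp (-(α * E)) / E ^ 2) → 1 ≤ M → 0 < m₂ → 0 ≤ L →
      8 ≤ (R : ℝ) → 8 * L ≤ R → m₂ ≤ Δ → E₀ = R * Δ → α = L / E₀ →
      β = m₂ * Real.exp L * E₀ → (∀ E', 0 ≤ nhi E') → (∀ E', 0 < E' → nhi E' ≤ M * m₂ / E') →
      (∀ E', E₀ ≤ E' → nhi E' ≤ b E' + δ₀) → 0 ≤ δ₀ → δ₀ ≤ M →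
      ∀ E : ℝ, E₀ ≤ E →
        ∑ k ∈ Finset.Icc 1 ⌈E / (2 * Δ)⌉₊, nhi (E - ((k : ℝ) + 1) * Δ) * nhi ((k : ℝ) * Δ)
          ≤ 96 * Real.exp L * R * M * b E * (m₂ / Δ) + 3 * M * δ₀ * ⌈E / (2 * Δ)⌉₊ := by
  intro M m₂ L Δ E₀ α β δ₀ R b nhi hb hM hm₂ hL hR8 hRL hΔ hE₀ hα hβ h0 h2 h4 hδ₀ hδM E hE
  set K : ℕ := ⌈E / (2 * Δ)⌉₊ with hK
  set C : ℝ := 32 * Real.exp L * M * b E * (m₂ / Δ) with hC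
  have hM0 : 0 < M := lt_of_lt_of_le one_pos hM
  have hΔ0 : 0 < Δ := lt_of_lt_of_le hm₂ hΔ
  have hE₀pos : 0 < E₀ := by
    rw [hE₀]; exact mul_pos (by linarith) hΔ0
  have hEpos : 0 < E := by linarith
  have hβpos : 0 < β := by rw [hβ]; positivity
  have hbE : 0 < b E := barrier_pos hb hβpos hM0 hEpos.ne'
  have hC0 : 0 ≤ C := by positivity
  have hR0 : 0 ≤ (R : ℝ) := by linarith
  calc ∑ k ∈ Finset.Icc 1 K, nhi (E - ((k : ℝ) + 1) * Δ) * nhi ((k : ℝ) * Δ)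
      ≤ ∑ k ∈ Finset.Icc 1 K, (C * ((if k ≤ R then (1 : ℝ) else 0) + R / (k : ℝ) ^ 2)
          + 3 * M * δ₀) := by
        refine Finset.sum_le_sum fun k hk => ?_
        rw [Finset.mem_Icc] at hk
        exact merge_term_le hb hM hm₂ hL hR8 hRL hΔ hE₀ hα hβ h0 h2 h4 hδ₀ hδM hE hk.1 hk.2
    _ = C * ((∑ k ∈ Finset.Icc 1 K, (if k ≤ R then (1 : ℝ) else 0))
          + R * ∑ k ∈ Finset.Icc 1 K, ((k : ℝ) ^ 2)⁻¹) + 3 * M * δ₀ * K := by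
        rw [Finset.sum_add_distrib, Finset.sum_const, Nat.card_Icc, ← Finset.mul_sum,
          Finset.sum_add_distrib, Finset.mul_sum _ _ (R : ℝ)]
        simp only [div_eq_mul_inv, Nat.add_sub_cancel]
        ring
    _ ≤ C * (R + R * 2) + 3 * M * δ₀ * K := by
        have h1 := sum_Icc_indicator_le K R
        have h2 := mul_le_mul_of_nonneg_left (sum_Icc_inv_sq_le_two K) hR0
        have h3 := mul_le_mul_of_nonneg_left (add_le_add h1 h2) hC0
        linarith
    _ = 96 * Real.exp L * R * M * b E * (m₂ / Δ) + 3 * M * δ₀ * K := by rw [hC]; ring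

end Merge


end Summit.AtomisticToContinuum.HydrodynamicLimit.Theorems.EnergyCurrentTailsLevelCensus

end
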